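import Summits.ValiantsHypothesis.ValiantsHypothesis.Theorems.BinomialElusivePeelingLemmaGadget

/-!
# The theta gadget `Θ₅(L′, q)`, II: all arms share the branch vectors (the closing construction)

Helper for the crux stmt-ValiantsHypothesis-7391 (negative lane; `Cruxes/PeelingLemma/DETERMINISTIC-ALLX.md`
§1a, module [T]).  At position `2q` every arm `j` has the vector `ψ_b = Σ_a (-1)^a e_{beta a}`
(`win_b_beta`, `win_b_eq_zero`, `win_b_eq`), and at position `4q + no + 2 = 2q + L′` every arm has
`ψ_{b'} = Σ_a (-1)^a e_{beta' a}` (`win_b'_beta'`, `win_b'_eq_zero`, `win_b'_eq`): the arm-dependent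
age order at `b` (a transposition of two even ages) and the CLOSING births (x_j, then the letters of
`b'` except the kept one, interleaved by parity) are consistent.  Together with the pair-label
identity `win_add_win_succ` this makes every edge of the gadget an X-output.  No Theses import.
-/

namespace Summit.ValiantsHypothesis.ValiantsHypothesis.Theorems.PeelingLemmaGadget

-- summit = sub-problem name (single-conjunct summit, D-0017 layout), so the namespace repeats it
set_option linter.dupNamespace false

open scoped BigOperators
open Finset
open Summit.ValiantsHypothesis.ValiantsHypothesis.Theorems.PeelingLemmaWindow (win)

variable {q no : ℕ}

/-! ## The vertex vectors at the two branch vertices -/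

/-- `birth` at `n - i` for naturals `i ≤ n`. -/
theorem birth_sub_natCast (j : Fin 5) (n i : ℕ) (hi : i ≤ n) :
    birth q no j ((n : ℤ) - (i : ℤ)) = birthNat q no j (n - i) := by
  rw [← Nat.cast_sub hi, birth_natCast]

/-- The window vector at a natural position `n ≥ 2q`, expressed through `birthNat`. -/
theorem win_birth_apply (j : Fin 5) (n : ℕ) (hn : 2 * q ≤ n) (ν : GLetter q no) :
    win (birth q no j) q (n : ℤ) ν =
      ∑ i ∈ Finset.range (2 * q + 1), (-1) ^ i * (if birthNat q no j (n - i) = ν then 1 else 0) := by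
  unfold win
  refine Finset.sum_congr rfl fun i hi => ?_
  rw [birth_sub_natCast j n i (by have := Finset.mem_range.mp hi; omega)]

/-- If the letter `ν` is born at offset `i₀` below position `n` (and births are injective), its
coefficient in the window vector at `n` is `(-1)^{i₀}`. -/
theorem win_eq_of_hit (j : Fin 5) (n : ℕ) (hn : 2 * q ≤ n) (ν : GLetter q no) (i₀ : ℕ)
    (hi₀ : i₀ ≤ 2 * q) (hit : birthNat q no j (n - i₀) = ν) :
    win (birth q no j) q (n : ℤ) ν = (-1) ^ i₀ := by
  rw [win_birth_apply j n hn, Finset.sum_eq_single_of_mem i₀ (Finset.mem_range.mpr (by omega))]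
  · rw [if_pos hit, mul_one]
  · intro i hi hne
    rw [if_neg, mul_zero]
    intro h
    have h1 : birth q no j ((n - i : ℕ) : ℤ) = birth q no j ((n - i₀ : ℕ) : ℤ) := by
      rw [birth_natCast, birth_natCast, h, hit]
    have h2 := birth_injective j h1
    have h3 : n - i = n - i₀ := by exact_mod_cast h2
    have := Finset.mem_range.mp hi
    omega

/-- A letter not born in the window below `n` does not occur in the window vector at `n`. -/
theorem win_eq_zero_of_no_hit (j : Fin 5) (n : ℕ) (hn : 2 * q ≤ n) (ν : GLetter q no)
    (hno : ∀ i ≤ 2 * q, birthNat q no j (n - i) ≠ ν) : win (birth q no j) q (n : ℤ) ν = 0 := by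
  rw [win_birth_apply j n hn]
  refine Finset.sum_eq_zero fun i hi => ?_
  rw [if_neg (hno i (by have := Finset.mem_range.mp hi; omega)), mul_zero]

/-- Powers of `-1` depend only on the parity of the exponent. -/
theorem neg_one_pow_of_mod_two_eq {m n : ℕ} (h : m % 2 = n % 2) : ((-1 : ℤ) ^ m) = (-1) ^ n := by
  rw [neg_one_pow_eq_pow_mod_two (R := ℤ), h, ← neg_one_pow_eq_pow_mod_two (R := ℤ)]

/-- **Vertex vector at `b`.**  Every arm sees the same vector at position `2q`: the letter `beta a`
with coefficient `(-1)^a` … -/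
theorem win_b_beta (j : Fin 5) (a : Fin (2 * q + 1)) :
    win (birth q no j) q ((2 * q : ℕ) : ℤ) (GLetter.beta a) = (-1) ^ (a : ℕ) := by
  have hi₀ : ((armAge q j a : Fin (2 * q + 1)) : ℕ) ≤ 2 * q := by
    have := (armAge q j a).isLt; omega
  rw [win_eq_of_hit j (2 * q) le_rfl (GLetter.beta a) _ hi₀]
  · exact neg_one_pow_of_mod_two_eq (armAge_parity q j a)
  · rw [birthNat_beta j (by omega)]
    have : (⟨2 * q - (2 * q - ((armAge q j a : Fin (2 * q + 1)) : ℕ)), by omega⟩ : Fin (2 * q + 1))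
        = armAge q j a := Fin.ext (by simp only; omega)
    rw [this]
    simp [armAge, Equiv.swap_apply_self]

/-- … and no other letter. -/
theorem win_b_eq_zero (j : Fin 5) (ν : GLetter q no) (hν : ∀ a, ν ≠ GLetter.beta a) :
    win (birth q no j) q ((2 * q : ℕ) : ℤ) ν = 0 := by
  refine win_eq_zero_of_no_hit j (2 * q) le_rfl ν fun i hi => ?_
  rw [birthNat_beta j (by omega)]
  exact fun h => hν _ h.symm

/-- **Vertex vector at `b'`.**  Every arm sees the same vector at position `4q + no + 2 = 2q + L′`:
the letter `beta' a` with coefficient `(-1)^a` … -/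
theorem win_b'_beta' (j : Fin 5) (a : Fin (2 * q + 1)) :
    win (birth q no j) q ((4 * q + no + 2 : ℕ) : ℤ) (GLetter.beta' a) = (-1) ^ (a : ℕ) := by
  have ha := a.isLt
  have hee := evenAge_even q j
  by_cases h0 : a = evenAge q j
  · -- the kept letter, born at `b'` itself
    rw [win_eq_of_hit j _ (by omega) _ 0 (by omega) (by rw [Nat.sub_zero, birthNat_kept, h0])]
    subst h0
    exact neg_one_pow_of_mod_two_eq (by rw [hee])
  by_cases hodd : (a : ℕ) % 2 = 1
  · -- a minus letter of `b'`: closing birth number `a + 1`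
    have hit : birthNat q no j (4 * q + no + 2 - (2 * q - a)) = GLetter.beta' a := by
      rw [birthNat_closing j (by omega) (by omega)]
      unfold closing
      rw [if_pos (by omega)]
      congr 1; exact Fin.ext (by simp only; omega)
    rw [win_eq_of_hit j _ (by omega) _ (2 * q - a) (by omega) hit]
    exact neg_one_pow_of_mod_two_eq (by omega)
  · -- a plus letter of `b'` other than the kept one: closing birth number `2k+1`
    have h0' : (a : ℕ) ≠ (evenAge q j : ℕ) := fun h => h0 (Fin.ext h)
    let k : ℕ := if (a : ℕ) < (evenAge q j : ℕ) then (a : ℕ) / 2 else (a : ℕ) / 2 - 1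
    have hk : k < q := by
      have : (evenAge q j : ℕ) ≤ 2 * q := by have := (evenAge q j).isLt; omega
      simp only [k]; split_ifs <;> omega
    have hskip : skipAge q j k = a := by
      apply Fin.ext
      unfold skipAge
      simp only [k]
      split_ifs with h1 h2 h3 <;> omega
    have hit : birthNat q no j (4 * q + no + 2 - (2 * q - 2 * k)) = GLetter.beta' a := by
      rw [birthNat_closing j (by omega) (by omega)]
      unfold closing
      rw [if_neg (by omega)]
      congr 1
      rw [← hskip]; congr 1; omega
    rw [win_eq_of_hit j _ (by omega) _ (2 * q - 2 * k) (by omega) hit]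
    exact neg_one_pow_of_mod_two_eq (by omega)

/-- … and no other letter. -/
theorem win_b'_eq_zero (j : Fin 5) (ν : GLetter q no) (hν : ∀ a, ν ≠ GLetter.beta' a) :
    win (birth q no j) q ((4 * q + no + 2 : ℕ) : ℤ) ν = 0 := by
  refine win_eq_zero_of_no_hit j _ (by omega) ν fun i hi => ?_
  rcases Nat.eq_zero_or_pos i with h0 | h0
  · subst h0; rw [Nat.sub_zero, birthNat_kept]; exact fun h => hν _ h.symm
  · rw [birthNat_closing j (by omega) (by omega)]
    obtain ⟨a, ha, -, -⟩ := closing_eq_beta' (q := q) (no := no) j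
      (i := 4 * q + no + 2 - i - (2 * q + no + 1)) (by omega) (by omega)
    rw [ha]; exact fun h => hν _ h.symm

/-- **Common branch vectors.**  All five arms have the same vertex vector at `b` and at `b'`. -/
theorem win_b_eq (j j' : Fin 5) :
    win (birth q no j) q ((2 * q : ℕ) : ℤ) = win (birth q no j') q ((2 * q : ℕ) : ℤ) := by
  funext ν
  by_cases h : ∃ a, ν = GLetter.beta a
  · obtain ⟨a, rfl⟩ := h; rw [win_b_beta, win_b_beta]
  · push Not at h; rw [win_b_eq_zero j ν h, win_b_eq_zero j' ν h]

/-- All arms have the same vertex vector at `b'`. -/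
theorem win_b'_eq (j j' : Fin 5) :
    win (birth q no j) q ((4 * q + no + 2 : ℕ) : ℤ) = win (birth q no j') q ((4 * q + no + 2 : ℕ) : ℤ) := by
  funext ν
  by_cases h : ∃ a, ν = GLetter.beta' a
  · obtain ⟨a, rfl⟩ := h; rw [win_b'_beta', win_b'_beta']
  · push Not at h; rw [win_b'_eq_zero j ν h, win_b'_eq_zero j' ν h]


end Summit.ValiantsHypothesis.ValiantsHypothesis.Theorems.PeelingLemmaGadget
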